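import Summits.BirchSwinnertonDyer.BirchSwinnertonDyer.Theorems.SignedLowerHalvesKobayashiLowerHalfLargeImageParityStratumOrder
import Summits.BirchSwinnertonDyer.Rank2.LambdaCongruenceModP
import HarnessLib

/-!
# Route `SignedLowerHalves`, crux 3 `KobayashiLowerHalfLargeImage` (item stmt-BirchSwinnertonDyer-19001):
# the `λ = 2` STRATUM, part 1 — the algebra of the stratum and its sign: `(μ, λ)(L_p^ε) = (0, 2)` at
# the conductor level forces `w(E) = +1`, hence an EVEN `corank_{ℤ_p} Sel_{p^∞}(E/ℚ) ≤ 2`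
# (cell `bsd-ssimc`, width seat `bsd-line-slh-p1-w2` gen 6; helper file `--supports 19001`; executes
# the stratum-bookkeeping note §4 of `Cruxes/KobayashiLowerHalfLargeImage/K1G17-SEARCH-LOG.md`)

HONEST FRAMING: the crux (the Eisenstein half of Kobayashi's signed main conjecture on the X7
large-image class) is OPEN and nothing here proves it for the class; BSD is not proved by any of
this. CONDITIONAL theorems: every non-proved input is a DISPLAYED binder — here the `p`-parity
theorem (`hpar : p_parity W p`), Sprung's functional equation of the signed pair (`hFE`, a tree
THEOREM since p638629, kept as a binder to compose with parts 1–4 of the parity stratum), Kobayashi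
2003 Thm. 1.2 (`h12`) and the RATIONAL Thm. 4.1 (`h41`) — and ONE per-pair certificate
"`μ(L_p^ε) = 0 ∧ λ(L_p^ε) = 2`". CALIBRATION / SUPPORT ONLY (pen rule D34-4 (3)): never an input to
a registered stub, never a `closes`, never a by-name close of the item.

## Position (after the LEAD's parity stratum, `…ParityStratum{,MainConjecture,Crux,Order,FE}.lean`)

Those files close the Eisenstein half at every pair with `(μ, λ)(L_p^ε) = (0, ≤ 1)`. At a pair with
root number `+1` the `T`-order of `L_p^ε` is even (`rootNumber_eq_neg_one_pow_order`), so `λ = 1`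
does not occur there and `λ = 2` is the FIRST open stratum at analytic rank `0` — the rows with
`p ∣ L(E,1)/Ω_E`. Parts 2–3 (`…LambdaTwoStratumMainConjecture.lean`, `…LambdaTwoStratumCrux.lean`)
close that stratum wherever the signed Selmer module `X^ε` is non-trivial for a PUBLISHED reason
(`corank Sel_{p^∞}(E/ℚ) ≠ 0`, or `Sel_{p^∞}(E/ℚ)` finite with `p ∣ ∏ c_ℓ · #Sel_{p^∞}(E/ℚ)`), and
name what is left (the one-element rank-`0` converse, K1G17 §4 (b)).

## What this file does

* §1 (pure algebra in `Λ = ℤ_p⟦T⟧`, `p` odd)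
  `constantCoeff_eq_zero_of_subst_eq_mul` — two-coefficient rigidity under a functional equation
  with an ARBITRARY multiplier: `p ∣ ξ(0)`, `p ∤ [T¹]ξ`, `ξ(T^ι) = u·ξ` ⇒ `ξ(0) = 0` (the shape in
  which the ALGEBRAIC functional equation `ι ξ = u ξ`, `u ∈ Λˣ` unknown, is consumed in part 2);
  `false_of_lam_two_shape_of_subst_eq_neg` — `p ∣ a₁, p ∤ a₂` (`λ = 2`, `μ = 0`) and
  `L(T^ι) = −u·L`, `u(0) = 1` is IMPOSSIBLE (divide by `T` and apply part 1 §1 of the parity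
  stratum, `sign_eq_neg_one_and_constantCoeff_eq_zero_of_subst_eq`, to `L/T`, whose sign is `+1`);
  `dvd_coeff_of_lt_lam`, `not_dvd_coeff_lam` — reading `λ` on coefficients when `μ = 0` (via the tree's `Rank2.pfree_eq_self_of_mu_eq_zero`);
  `span_eq_span_of_dvd_of_lam_le` — the `λ`-squeeze `ξ ∣ L`, `μ(L) = 0`, `λ(L) ≤ λ(ξ) ⇒ (ξ) = (L)`.
* §2 (at the conductor level) `rootNumber_eq_one_of_lam_eq_two` — `(μ, λ)(L_p^ε) = (0, 2) ⇒
  w(E) = +1` (granted `hFE`); `even_selmerCorank_of_lam_eq_two` (+ `hpar`);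
  `selmerCorank_le_two_of_lam_eq_two` (+ `h12`, `h41` rational: `corank ≤ ord_T ≤ λ`). So on the
  stratum `corank_{ℤ_p} Sel_{p^∞}(E/ℚ) ∈ {0, 2}`: at analytic rank `0` the dichotomy «Selmer finite»
  / «corank `2`» that parts 2–3 treat.

References: [Sprung2017] Cor. 4.14; [Pollack2003] Prop. 6.18; [DokchitserDokchitserAnnals2010] Thm. 1.4;
[Kobayashi2003] Thm. 1.2, Thm. 4.1; [GreenbergLNM1716] §1 pp. 67–68, §3 Lemma 3.1, §5 p. 181;
[GreenbergVatsal2000] pp. 2–4; [Kato2004] Thm. 18.4. Crux dir: `K1G17-SEARCH-LOG.md` §4.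
-/

set_option autoImplicit false
set_option linter.dupNamespace false

noncomputable section

open scoped Classical MatrixGroups ModularForm

open CongruenceSubgroup PowerSeries WeierstrassCurve Literature.NumberTheory.EllipticCurves
  Literature.NumberTheory.EllipticCurves.ModularForms Literature.Barriers.BirchSwinnertonDyer
  Literature.NumberTheory.EllipticCurves.Rank1Residual Literature.NumberTheory.EllipticCurves.Sprung2017
  Literature.NumberTheory.EllipticCurves.Kobayashi2003 ZpExtension
  Literature.NumberTheory.EllipticCurves.Rank1Residual.Typed
  Summit.BirchSwinnertonDyer.Rank1Residual Summit.BirchSwinnertonDyer.Rank1Residual.X1.MuLambda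
  Summit.BirchSwinnertonDyer.Rank1Residual.Supersingular
  Summit.BirchSwinnertonDyer.BirchSwinnertonDyer.Theorems.LargeImageParityStratum

namespace Summit.BirchSwinnertonDyer.BirchSwinnertonDyer.Theorems.LargeImageLambdaTwoStratum

/-! ## §1. Algebra in `Λ = ℤ_p⟦T⟧` -/

section Algebra

variable {p : ℕ} [Fact p.Prime]

/-- `p ∤ 2` in `ℤ_p` for an odd prime `p`. [folklore] -/
theorem not_dvd_two (hp : p ≠ 2) : ¬ (p : ℤ_[p]) ∣ (2 : ℤ_[p]) := by
  intro h
  have h' : ‖((2 : ℤ) : ℤ_[p])‖ < 1 := by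
    rw [PadicInt.norm_lt_one_iff_dvd]
    exact_mod_cast h
  rw [PadicInt.norm_int_lt_one_iff_dvd] at h'
  have h2 : (p : ℤ) ∣ 2 := h'
  have : p ∣ 2 := by exact_mod_cast h2
  exact hp ((Nat.prime_dvd_prime_iff_eq (Fact.out : p.Prime) Nat.prime_two).mp this)

/-- **Two-coefficient rigidity of a functional equation with an ARBITRARY multiplier (`p` odd).**
Let `ξ ∈ Λ = ℤ_p⟦T⟧` with `p ∣ ξ(0)` and `p ∤ [T¹]ξ` (i.e. `μ(ξ) = 0`, `λ(ξ) = 1`), and suppose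
`ξ(T^ι) = u · ξ` for SOME `u ∈ Λ` (no condition on `u(0)`), where `(1+T)(1+T^ι) = 1`. Then
`ξ(0) = 0`, i.e. `T ∣ ξ`. Proof: the `T⁰`-coefficients give `ξ₀ = u₀ ξ₀`, the `T¹`-coefficients
`−ξ₁ = u₀ ξ₁ + u₁ ξ₀`; if `ξ₀ ≠ 0` then `u₀ = 1` and `2ξ₁ = −u₁ξ₀ ∈ pℤ_p`, impossible. This is the
form in which the ALGEBRAIC functional equation `ι(ξ) = (ξ)` of a characteristic ideal (B. D. Kim
2008; Greenberg LNM 1716 §5: "`(1+a)⁻¹ − 1` is also a root … `a = 0`") is consumed: a simple zero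
of a self-dual characteristic power series in the open unit disc sits at `T = 0`.
[cite: GreenbergLNM1716, §5 (p. 181)] [cite: KimBD2008MRL, §1 p. 83 ("(a) = (a^ι)")] -/
theorem constantCoeff_eq_zero_of_subst_eq_mul (hp : p ≠ 2) {ι u ξ : IwasawaAlgebra p}
    (hι : (1 + X : IwasawaAlgebra p) * (ι + 1) = 1)
    (h0 : (p : ℤ_[p]) ∣ constantCoeff ξ) (h1 : ¬ (p : ℤ_[p]) ∣ coeff 1 ξ)
    (hFE : ξ.subst ι = u * ξ) : constantCoeff ξ = 0 := by
  have hι0 : constantCoeff ι = 0 := constantCoeff_eq_zero_of_one_add_X_mul hι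
  have hι1 : coeff 1 ι = -1 := by
    have h := congr_arg (coeff 1) hι
    simp only [mul_add, mul_one, add_mul, one_mul, map_add, coeff_one, if_neg one_ne_zero,
      coeff_one_X, coeff_succ_X_mul, coeff_zero_eq_constantCoeff, hι0] at h
    linear_combination h
  -- the two lowest coefficients of `ξ(T^ι)`
  have c0 : coeff 0 (ξ.subst ι) = constantCoeff ξ := by
    rw [coeff_subst_eq_sum_range hι0 ξ 0, Finset.sum_range_one, pow_zero, coeff_zero_one, one_mul,
      coeff_zero_eq_constantCoeff]
  have c1 : coeff 1 (ξ.subst ι) = -coeff 1 ξ := by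
    rw [coeff_subst_eq_sum_range hι0 ξ 1, Finset.sum_range_succ, Finset.sum_range_one, pow_zero,
      pow_one, coeff_one, if_neg one_ne_zero, zero_mul, zero_add, hι1, neg_one_mul]
  -- the two lowest coefficients of `u · ξ`
  have d0 : coeff 0 (u * ξ) = constantCoeff u * constantCoeff ξ := by
    rw [coeff_zero_eq_constantCoeff, map_mul]
  have d1 : coeff 1 (u * ξ) = constantCoeff u * coeff 1 ξ + coeff 1 u * constantCoeff ξ := by
    rw [coeff_mul, Finset.Nat.sum_antidiagonal_succ, Finset.Nat.antidiagonal_zero,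
      Finset.sum_singleton]
    show coeff 0 u * coeff 1 ξ + coeff 1 u * coeff 0 ξ = _
    rw [coeff_zero_eq_constantCoeff]
  by_contra hne
  have e0 := congr_arg (coeff 0) hFE
  rw [c0, d0] at e0
  -- `ξ₀ (1 - u₀) = 0`, `ξ₀ ≠ 0` ⇒ `u₀ = 1`
  have hu0 : constantCoeff u = 1 := by
    have h : constantCoeff ξ * (1 - constantCoeff u) = 0 := by linear_combination e0
    rcases mul_eq_zero.mp h with h | h
    · exact absurd h hne
    · linear_combination -h
  have e1 := congr_arg (coeff 1) hFE
  rw [c1, d1, hu0, one_mul] at e1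
  apply h1
  have h2 : (2 : ℤ_[p]) * coeff 1 ξ = -(coeff 1 u * constantCoeff ξ) := by linear_combination -e1
  have hdvd : (p : ℤ_[p]) ∣ 2 * coeff 1 ξ := by
    rw [h2]; exact (Dvd.dvd.mul_left h0 _).neg_right
  exact ((PadicInt.prime_p (p := p)).dvd_or_dvd hdvd).resolve_left (not_dvd_two hp)

/-- `T^ι = −T · (1 + T^ι)` when `(1+T)(1+T^ι) = 1`. [folklore] -/
theorem iota_eq_neg_X_mul {ι : IwasawaAlgebra p} (hι : (1 + X : IwasawaAlgebra p) * (ι + 1) = 1) :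
    ι = -X * (ι + 1) := by
  linear_combination hι

/-- **The `λ = 2` shape forbids the sign `−1` (`p` odd).** Let `L ∈ Λ` with `p ∣ a₁`, `p ∤ a₂`
(`aᵢ = [Tⁱ]L`; e.g. `μ(L) = 0`, `λ(L) = 2`) and suppose `L(T^ι) = −u · L` with `u(0) = 1`.
This is impossible: the `T⁰`-coefficients give `2a₀ = 0`, so `L = T · L₁`, and since
`T^ι = −T(1+T^ι)` the series `L₁` satisfies `L₁(T^ι) = +((1+T)u) · L₁` with `p ∣ L₁(0) = a₁`,
`p ∤ [T¹]L₁ = a₂` — contradicting the two-coefficient engine of part 1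
(`sign_eq_neg_one_and_constantCoeff_eq_zero_of_subst_eq`: such an `L₁` has sign `−1`). Greenberg's
pairing of zeros `a ↔ (1+a)⁻¹ − 1` read on three coefficients: two zeros in the open disc with an odd
functional equation would have to be `{0, 0}`, but `ord_T L = 1`.
[cite: GreenbergLNM1716, §5 (p. 181)] -/
theorem false_of_lam_two_shape_of_subst_eq_neg (hp : p ≠ 2) {ι u L : IwasawaAlgebra p}
    (hι : (1 + X : IwasawaAlgebra p) * (ι + 1) = 1) (hu : constantCoeff u = 1)
    (h1 : (p : ℤ_[p]) ∣ coeff 1 L) (h2 : ¬ (p : ℤ_[p]) ∣ coeff 2 L)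
    (hFE : L.subst ι = -u * L) : False := by
  have hι0 : constantCoeff ι = 0 := constantCoeff_eq_zero_of_one_add_X_mul hι
  have hsub : HasSubst ι := HasSubst.of_constantCoeff_zero' hι0
  -- `a₀ = 0`: compare constant coefficients (`L(T^ι)(0) = L(0)`, `(-uL)(0) = -L(0)`)
  have c0 : coeff 0 (L.subst ι) = constantCoeff L := by
    rw [coeff_subst_eq_sum_range hι0 L 0, Finset.sum_range_one, pow_zero, coeff_zero_one, one_mul,
      coeff_zero_eq_constantCoeff]
  have ha0 : constantCoeff L = 0 := by
    have e0 := congr_arg (coeff 0) hFE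
    rw [c0, coeff_zero_eq_constantCoeff, map_mul, map_neg, hu] at e0
    have h : (2 : ℤ_[p]) * constantCoeff L = 0 := by linear_combination e0
    exact (mul_eq_zero.mp h).resolve_left two_ne_zero
  -- `L = T · L₁`
  obtain ⟨L₁, hL₁⟩ := X_dvd_iff.mpr ha0
  -- the coefficients of `L₁`
  have hc0 : constantCoeff L₁ = coeff 1 L := by
    rw [hL₁, coeff_succ_X_mul, coeff_zero_eq_constantCoeff]
  have hc1 : coeff 1 L₁ = coeff 2 L := by
    rw [hL₁, coeff_succ_X_mul]
  -- the functional equation of `L₁`: `T^ι · L₁(T^ι) = -u · T · L₁`, `T^ι = -T(1+T^ι)`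
  have hFE₁ : ι * L₁.subst ι = -u * (X * L₁) := by
    have h := hFE
    rw [hL₁, subst_mul hsub, subst_X hsub] at h
    exact h
  have hιX : ι = -X * (ι + 1) := iota_eq_neg_X_mul hι
  have hX0 : (X : IwasawaAlgebra p) ≠ 0 := X_ne_zero
  have hFE₂ : (ι + 1) * L₁.subst ι = u * L₁ := by
    have h : -X * ((ι + 1) * L₁.subst ι) = -X * (u * L₁) := by
      rw [← mul_assoc, ← hιX, hFE₁]; ring
    exact mul_left_cancel₀ (neg_ne_zero.mpr hX0) h
  have hFE₃ : L₁.subst ι = ((1 : ℤ) : IwasawaAlgebra p) * ((1 + X) * u) * L₁ := by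
    have h : (1 + X : IwasawaAlgebra p) * ((ι + 1) * L₁.subst ι) = (1 + X) * (u * L₁) := by
      rw [hFE₂]
    rw [← mul_assoc, hι, one_mul] at h
    rw [h, Int.cast_one, one_mul, mul_assoc]
  have hu' : constantCoeff ((1 + X : IwasawaAlgebra p) * u) = 1 := by
    rw [map_mul, map_add, map_one, constantCoeff_X, add_zero, one_mul, hu]
  have h0' : (p : ℤ_[p]) ∣ constantCoeff L₁ := by rw [hc0]; exact h1
  have h1' : ¬ (p : ℤ_[p]) ∣ coeff 1 L₁ := by rw [hc1]; exact h2
  have key := (sign_eq_neg_one_and_constantCoeff_eq_zero_of_subst_eq (σ := 1) (by norm_num) hp hι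
    hu' h0' h1' hFE₃).1
  omega

/-- **Reading `λ` on coefficients, I** (`μ = 0`): every coefficient of index `< λ(g)` is divisible
by `p`. [cite: GreenbergVatsal2000, p. 2–3, (1)–(2)] -/
theorem dvd_coeff_of_lt_lam {g : IwasawaAlgebra p} (hμ : mu g = 0) {i : ℕ} (hi : i < lam g) :
    (p : ℤ_[p]) ∣ coeff i g := by
  have h : coeff i (red (pfree g)) = 0 := coeff_of_lt_order_toNat i hi
  rw [Rank2.pfree_eq_self_of_mu_eq_zero hμ, coeff_map, IsLocalRing.residue_eq_zero_iff,
    PadicInt.maximalIdeal_eq_span_p, Ideal.mem_span_singleton] at h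
  exact h

/-- **Reading `λ` on coefficients, II** (`μ = 0`, `g ≠ 0`): the coefficient of index `λ(g)` is a
`p`-adic unit (not divisible by `p`). [cite: GreenbergVatsal2000, p. 2–3, (1)–(2)] -/
theorem not_dvd_coeff_lam {g : IwasawaAlgebra p} (hg : g ≠ 0) (hμ : mu g = 0) :
    ¬ (p : ℤ_[p]) ∣ coeff (lam g) g := by
  intro h
  have hred : red (pfree g) ≠ 0 := red_pfree_ne_zero hg
  have hne : coeff (lam g) (red (pfree g)) ≠ 0 := coeff_order hred
  apply hne
  rw [Rank2.pfree_eq_self_of_mu_eq_zero hμ, coeff_map, IsLocalRing.residue_eq_zero_iff,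
    PadicInt.maximalIdeal_eq_span_p, Ideal.mem_span_singleton]
  exact h

/-- A `p`-adic integer divisible by `p` is not a unit. [folklore] -/
theorem not_isUnit_of_dvd {x : ℤ_[p]} (h : (p : ℤ_[p]) ∣ x) : ¬ IsUnit x := by
  intro hu
  have h1 : ‖x‖ < 1 := (PadicInt.norm_lt_one_iff_dvd x).mpr h
  rw [PadicInt.isUnit_iff] at hu
  exact h1.ne hu

/-- **The `λ`-squeeze (pure algebra).** In `Λ`: if `ξ ∣ L`, `μ(L) = 0` and `λ(L) ≤ λ(ξ)`, then
`(ξ) = (L)` (the cofactor has `μ = λ = 0`, i.e. is a unit; Greenberg–Vatsal p. 4).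
[cite: GreenbergVatsal2000, p. 4 (after Thm. (1.2))] -/
theorem span_eq_span_of_dvd_of_lam_le {ξ L : IwasawaAlgebra p} (hL : L ≠ 0) (hdvd : ξ ∣ L)
    (hμ : mu L = 0) (hlam : lam L ≤ lam ξ) :
    Ideal.span ({ξ} : Set (IwasawaAlgebra p)) = Ideal.span {L} := by
  obtain ⟨h, hh⟩ := hdvd
  have hξ : ξ ≠ 0 := fun h0 ↦ hL (by rw [hh, h0, zero_mul])
  exact ((span_eq_span_iff_mu_le_and_lam_le hξ hL hh).mpr ⟨by rw [hμ]; exact Nat.zero_le _, hlam⟩).symm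

end Algebra

/-! ## §2. At the conductor level: `(μ, λ)(L_p^ε) = (0, 2)` forces `w(E) = +1`, even corank `≤ 2` -/

section Sign

variable (W : WeierstrassCurve ℚ) [W.IsElliptic] [W.IsGloballyMinimal] (p : ℕ) [Fact p.Prime]

/-- Kobayashi's `L_p^ε` picked out of a Pollack pair is non-zero (Pollack Cor. 5.11, carried by
`IsPollackPair`). [cite: Pollack2003, Cor. 5.11] -/
theorem kobayashiL_ne_zero {N : ℕ} {f : CuspForm (Gamma0 N) 2} {Lplus Lminus : IwasawaAlgebra p}
    (hPP : IsPollackPair f p Lplus Lminus) (ε : ℤˣ) : kobayashiL ε Lplus Lminus ≠ 0 := by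
  rw [kobayashiL]
  split_ifs
  · exact hPP.2.1
  · exact hPP.1

/-- **`(μ, λ)(L_p^ε) = (0, 2)` at the conductor level forces `w(E) = +1`.** Let `p` be an odd good
prime of `E = W` with `a_p = 0`, `f ∈ S₂(Γ₀(N_E))` its newform, `(L⁺, L⁻)` a Pollack pair and `ε` a
sign with `μ(L_p^ε) = 0`, `λ(L_p^ε) = 2` (`L_p^ε = kobayashiL ε L⁺ L⁻`, Kobayashi's labelling).
Granted Sprung's functional equation of the pair (`hFE`, Cor. 4.14 at `a_p = 0`:
`L^•(T^ι) = σ (1+T)^{c+·} L^•` with `w_N f = −σ f`): `W.rootNumber = 1`. At level `N_E` the sign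
`σ` IS the root number (`rootNumber_eq_neg_frickeEigenvalue` + Atkin–Lehner, tree theorems), and
`σ = −1` is excluded by §1 (`false_of_lam_two_shape_of_subst_eq_neg`: `p ∣ a₁`, `p ∤ a₂`).
CONDITIONAL on `hFE` only. [cite: Sprung2017, Cor. 4.14 (a_p = 0 display) and §3.5]
[cite: GreenbergLNM1716, §1 (pp. 67–68) and §5 (p. 181)] [cite: Pollack2003, Prop. 6.18] -/
theorem rootNumber_eq_one_of_lam_eq_two
    (hFE : Sprung2017.cor414_sharpFlat_functionalEquation_apZero)
    (hp : p ≠ 2) (hgood : W.HasGoodReductionAtPrime p) (hap : W.frobeniusTrace p = 0)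
    [NeZero (W.conductorNorm ℤ)] {f : CuspForm (Gamma0 (W.conductorNorm ℤ)) 2} (hf : IsNewformOf W f)
    {Lplus Lminus : IwasawaAlgebra p} (hPP : IsPollackPair f p Lplus Lminus) (ε : ℤˣ)
    (hμ : mu (kobayashiL ε Lplus Lminus) = 0) (hlam : lam (kobayashiL ε Lplus Lminus) = 2) :
    W.rootNumber = 1 := by
  -- the sign dictionary at level `N_W`: `w_N f = -w(E) f`
  have hw : (W.rootNumber : ℂ) = -frickeEigenvalue f :=
    rootNumber_eq_neg_frickeEigenvalue (fun _ _ ↦ IsNewform0.exists_functional_equation_holds)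
      (fun _ _ ↦ IsNewform0.frickeEigenvalue_eq_one_or_eq_neg_one_holds) hf
  have hsm := IsNewform0.frickeInvolution_eq_smul_holds (N := W.conductorNorm ℤ) (k := (2 : ℤ)) hf.1
  have hFr : IsFrickeEigen (W.conductorNorm ℤ) f (frickeEigenvalue f) :=
    isFrickeEigen_of_frickeInvolution_eq_smul _ hsm
  have hWσ : IsFrickeEigen (W.conductorNorm ℤ) f (-((W.rootNumber : ℤ) : ℂ)) := by
    rw [hw, neg_neg]; exact hFr
  have hσ : W.rootNumber ^ 2 = 1 := by
    rcases W.rootNumber_eq_one_or with h | h <;> rw [h] <;> norm_num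
  -- the exponent of `⟨N⟩`, the constants `a, b`, the Sprung pair
  have hpN : ¬ p ∣ W.conductorNorm ℤ := not_dvd_level_of_isNewformOf hf hgood
  obtain ⟨ηN, c, hc⟩ := exists_teichmuller_exponent_natCast p hpN
  obtain ⟨a, b, ha, hb⟩ := exists_sprung_exponents (p := p)
  have hSP : IsSprungPair f p 0 Lplus Lminus :=
    (isSprungPair_zero_iff f p Lplus Lminus).mpr ⟨hPP.2.2.1, hPP.2.2.2⟩
  set ι : IwasawaAlgebra p := invOnePlusSubOne with hιdef
  have hι : (1 + X : IwasawaAlgebra p) * (ι + 1) = 1 := one_add_X_mul_invOnePlusSubOne_add_one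
  obtain ⟨hs, hfl⟩ := hFE p W (W.conductorNorm ℤ) f hp hf hgood hap W.rootNumber hσ hWσ ηN c hc a b
    ha hb ι hι Lplus Lminus hSP
  -- the component of the sign `ε`
  set L := kobayashiL ε Lplus Lminus with hLdef
  obtain ⟨e, he⟩ : ∃ e : ℤ_[p], L.subst ι =
      (W.rootNumber : IwasawaAlgebra p) * binomialSeries ℤ_[p] e * L := by
    rw [hLdef, kobayashiL]
    split_ifs
    · exact ⟨c + b, hfl⟩
    · exact ⟨c + a, hs⟩
  have hL0 : L ≠ 0 := kobayashiL_ne_zero p hPP ε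
  -- `w(E) = -1` is impossible on the `λ = 2` shape
  rcases W.rootNumber_eq_one_or with h1 | hm1
  · exact h1
  · exfalso
    have hFE' : L.subst ι = -binomialSeries ℤ_[p] e * L := by
      rw [he, hm1, Int.cast_neg, Int.cast_one, neg_one_mul]
    have h1 : (p : ℤ_[p]) ∣ coeff 1 L := dvd_coeff_of_lt_lam hμ (by rw [hlam]; exact one_lt_two)
    have h2 : ¬ (p : ℤ_[p]) ∣ coeff 2 L := by rw [← hlam]; exact not_dvd_coeff_lam hL0 hμ
    exact false_of_lam_two_shape_of_subst_eq_neg hp hι (binomialSeries_constantCoeff (A := ℤ_[p]) e)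
      h1 h2 hFE'

/-- **`(μ, λ)(L_p^ε) = (0, 2) ⇒ corank_{ℤ_p} Sel_{p^∞}(E/ℚ)` is even**, granted the `p`-parity
theorem (`hpar : p_parity W p`, `(−1)^{corank} = w(E)`; Dokchitser–Dokchitser 2010 Thm. 1.4, at good
supersingular `p > 3` B. D. Kim 2007) and Sprung's functional equation (`hFE`): the previous theorem
gives `w(E) = +1`. CONDITIONAL on the two named facts. [cite: DokchitserDokchitserAnnals2010, Thm. 1.4]
[cite: Sprung2017, Cor. 4.14 (a_p = 0 display)] -/
theorem even_selmerCorank_of_lam_eq_two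
    (hpar : p_parity W p) (hFE : Sprung2017.cor414_sharpFlat_functionalEquation_apZero)
    (hp : p ≠ 2) (hgood : W.HasGoodReductionAtPrime p) (hap : W.frobeniusTrace p = 0)
    [NeZero (W.conductorNorm ℤ)] {f : CuspForm (Gamma0 (W.conductorNorm ℤ)) 2} (hf : IsNewformOf W f)
    {Lplus Lminus : IwasawaAlgebra p} (hPP : IsPollackPair f p Lplus Lminus) (ε : ℤˣ)
    (hμ : mu (kobayashiL ε Lplus Lminus) = 0) (hlam : lam (kobayashiL ε Lplus Lminus) = 2) :
    Even (W.selmerCorank p) := by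
  have hw := rootNumber_eq_one_of_lam_eq_two W p hFE hp hgood hap hf hPP ε hμ hlam
  have h : (-1 : ℤ) ^ W.selmerCorank p = W.rootNumber := hpar
  rw [hw] at h
  exact (neg_one_pow_eq_one_iff_even (R := ℤ) (by norm_num)).mp h

/-- **`(μ, λ)(L_p^ε) = (0, 2) ⇒ corank_{ℤ_p} Sel_{p^∞}(E/ℚ) ≤ 2`**, granted Kobayashi Thm. 1.2 (`h12`)
and the RATIONAL Kato side Thm. 4.1 (`h41`, no image hypothesis): `corank ≤ ord_T L_p^ε`
(part 3 `selmerCorank_le_order`) and `ord_T L ≤ λ(L)` when `μ(L) = 0`. With the previous theorem: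
on the `λ = 2` stratum the corank is `0` or `2`. [cite: Kobayashi2003, Thm. 1.2 (p. 2) and Thm. 4.1 (p. 8)]
[cite: Kato2004, Thm. 18.4 (p. 281)] [cite: GreenbergLNM1716, §3 Lemma 3.1] -/
theorem selmerCorank_le_two_of_lam_eq_two
    (h12 : Kobayashi2003.thm12_signedSelmerDual_finite_torsion)
    (h41 : Kobayashi2003.thm41_signedCharIdeal_divisibility)
    (hp : p ≠ 2) (hgood : W.HasGoodReductionAtPrime p) (hap : W.frobeniusTrace p = 0)
    {N : ℕ} [NeZero N] {f : CuspForm (Gamma0 N) 2} (hf : IsNewformOf W f)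
    {Lplus Lminus : IwasawaAlgebra p} (hPP : IsPollackPair f p Lplus Lminus) (ε : ℤˣ)
    (hμ : mu (kobayashiL ε Lplus Lminus) = 0) (hlam : lam (kobayashiL ε Lplus Lminus) = 2) :
    W.selmerCorank p ≤ 2 := by
  have hL0 : kobayashiL ε Lplus Lminus ≠ 0 := kobayashiL_ne_zero p hPP ε
  have hle : (W.selmerCorank p : ℕ∞) ≤ (lam (kobayashiL ε Lplus Lminus) : ℕ∞) :=
    (selmerCorank_le_order W p h12 h41 hp hgood hap hf hPP ε).trans (order_le_lam_of_mu_eq_zero p hL0 hμ)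
  have hle' : W.selmerCorank p ≤ lam (kobayashiL ε Lplus Lminus) := by exact_mod_cast hle
  rwa [hlam] at hle'

end Sign

end Summit.BirchSwinnertonDyer.BirchSwinnertonDyer.Theorems.LargeImageLambdaTwoStratum

end
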